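import Literature.Analysis.OperatorTheory.KnabeGapAmplification
import Mathlib.Analysis.InnerProductSpace.Positive
import Mathlib.Analysis.SpecificLimits.Basic
import Mathlib.Data.ZMod.ValMinAbs

/-!
# Crux `LatticeGapInUVUnits`, line `knabe-block-sampler`: stub S1 `stub_knabeAmplification`

Support file for item stmt-QuantumFields-9366 (route `LangevinControlUV` of `YangMills`), registered stub
`stub_knabeAmplification` = `KnabeAmplification`: Knabe's local-gap amplification on the index torus `(ℤ/M)⁴` with
non-commuting radius `2` — some threshold `t n → 0` and constant `c > 0` satisfy
`Literature.Analysis.OperatorTheory.KnabeDevice.KnabeWith 2 t c` (Knabe 1988 §2; Gosset–Mozgunov 2016 Thm. 1).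
Squaring argument: `∑ₓ A_x² = ∑_{y,z} N(y,z) Q_y Q_z`; far pairs are products of commuting projections (`≥ 0`);
near pairs by `−(PQ+QP) ≤ P + Q` and the count `N(y,y) − N(y,z) ≤ 16 (2n−1)³` for the `5⁴` near partners,
whence the explicit threshold `t n = 10000 / n` and constant `c = 1`.
No definitions are introduced (vocabulary: `Literature/Analysis/OperatorTheory/KnabeGapAmplification.lean`).
-/

open scoped BigOperators InnerProductSpace
open Filter Topology
open Literature.Analysis.OperatorTheory.KnabeDevice

noncomputable section

namespace Summit.QuantumFields.YangMills.Theorems.LatticeGapInUVUnits.KnabeBlockSampler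

/-- The cyclic index distance is symmetric. -/
private theorem knabe_cdist_comm {M : ℕ} (i j : Fin M) : cdist i j = cdist j i := by
  unfold cdist
  rw [← ZMod.natAbs_valMinAbs_neg, neg_sub]

/-- Triangle inequality for the cyclic index distance. -/
private theorem knabe_cdist_triangle {M : ℕ} (i j l : Fin M) : cdist i l ≤ cdist i j + cdist j l := by
  unfold cdist
  have h : (((i : ℕ) : ZMod M) - ((l : ℕ) : ZMod M))
      = (((i : ℕ) : ZMod M) - ((j : ℕ) : ZMod M)) + ((((j : ℕ) : ZMod M)) - ((l : ℕ) : ZMod M)) := by abel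
  rw [h]
  exact (ZMod.natAbs_valMinAbs_add_le _ _).trans (Int.natAbs_add_le _ _)

/-- Ball count on the cycle `ℤ/M`: `#{x | cdist c x < r} = 2r - 1` when `2r ≤ M + 1`
(`ZMod.valMinAbs` is a bijection onto the integer window `(-M/2, M/2]`). -/
private theorem knabe_ball_card {M : ℕ} [NeZero M] (r : ℕ) (hr : 2 * r ≤ M + 1) (c : Fin M) :
    (Finset.univ.filter fun x : Fin M => cdist c x < r).card = 2 * r - 1 := by
  have key : (Finset.univ.filter fun x : Fin M => cdist c x < r).card = (Finset.Ioo (-(r : ℤ)) r).card := by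
    apply Finset.card_nbij' (fun x : Fin M => (((c : ℕ) : ZMod M) - ((x : ℕ) : ZMod M)).valMinAbs)
      (fun k : ℤ => (⟨(((c : ℕ) : ZMod M) - (k : ZMod M)).val, ZMod.val_lt _⟩ : Fin M))
    · intro x hx
      simp only [Finset.coe_filter, Finset.mem_univ, true_and, Set.mem_setOf_eq] at hx
      simp only [Finset.coe_Ioo, Set.mem_Ioo]
      unfold cdist at hx
      omega
    · intro k hk
      simp only [Finset.coe_Ioo, Set.mem_Ioo] at hk
      simp only [Finset.coe_filter, Finset.mem_univ, true_and, Set.mem_setOf_eq]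
      unfold cdist
      simp only [ZMod.natCast_zmod_val, sub_sub_cancel]
      have hk2 : ((k : ZMod M)).valMinAbs = k := by
        rw [ZMod.valMinAbs_spec]
        refine ⟨rfl, ?_, ?_⟩ <;> omega
      rw [hk2]
      omega
    · intro x _
      ext
      simp only [ZMod.coe_valMinAbs, sub_sub_cancel]
      exact ZMod.val_cast_of_lt x.isLt
    · intro k hk
      simp only [Finset.coe_Ioo, Set.mem_Ioo] at hk
      simp only [ZMod.natCast_zmod_val, sub_sub_cancel]
      rw [ZMod.valMinAbs_spec]
      refine ⟨rfl, ?_, ?_⟩ <;> omega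
  rw [key, Int.card_Ioo]
  omega

/-- Box count on the torus `(ℤ/M)⁴`: `#{x | ∀ k, cdist (c k) (x k) < r} = (2r - 1)⁴` when `2r ≤ M + 1`. -/
private theorem knabe_box_card {M : ℕ} [NeZero M] (r : ℕ) (hr : 2 * r ≤ M + 1) (c : Fin 4 → Fin M) :
    (Finset.univ.filter fun x : Fin 4 → Fin M => ∀ k, cdist (c k) (x k) < r).card = (2 * r - 1) ^ 4 := by
  have h : (Finset.univ.filter fun x : Fin 4 → Fin M => ∀ k, cdist (c k) (x k) < r)
      = Fintype.piFinset fun k => Finset.univ.filter fun a : Fin M => cdist (c k) a < r := by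
    ext x
    simp [Fintype.mem_piFinset]
  rw [h, Fintype.card_piFinset]
  simp [knabe_ball_card r hr]

/-- Diagonal pair count `N(y,y) = #{x | y ∈ patch(x)} = (2n-1)⁴`, as a real number. -/
private theorem knabe_count_diag {M : ℕ} [NeZero M] (n : ℕ) (hM : 2 * n ≤ M + 1) (y : Fin 4 → Fin M) :
    ∑ x : Fin 4 → Fin M, (if (∀ k, cdist (y k) (x k) < n) then (1 : ℝ) else 0) = ((2 * n - 1 : ℕ) : ℝ) ^ 4 := by
  rw [Finset.sum_boole, knabe_box_card n hM y, Nat.cast_pow]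

/-- Near-partner count: `#{z | ∀ k, cdist (y k) (z k) ≤ 2} = 5⁴ = 625`. -/
private theorem knabe_count_near {M : ℕ} [NeZero M] (hM : 6 ≤ M + 1) (y : Fin 4 → Fin M) :
    (Finset.univ.filter fun z : Fin 4 → Fin M => ∀ k, cdist (y k) (z k) ≤ 2).card = 625 := by
  have h : (Finset.univ.filter fun z : Fin 4 → Fin M => ∀ k, cdist (y k) (z k) ≤ 2)
      = Finset.univ.filter fun z : Fin 4 → Fin M => ∀ k, cdist (y k) (z k) < 3 := by
    ext z
    simp only [Finset.mem_filter, Finset.mem_univ, true_and]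
    exact forall_congr' fun k => by omega
  rw [h, knabe_box_card 3 hM y]
  norm_num

/-- Lower pair count for a near pair: `N(y,z) ≥ (2(n-2)-1)₊⁴`, since the box of radius `n - 2` around `y`
lies in both patches (triangle inequality). -/
private theorem knabe_count_near_lower {M : ℕ} [NeZero M] (n : ℕ) (hM : 2 * n ≤ M + 1)
    (y z : Fin 4 → Fin M) (hyz : ∀ k, cdist (y k) (z k) ≤ 2) :
    ((2 * (n - 2) - 1 : ℕ) : ℝ) ^ 4 ≤ ∑ x : Fin 4 → Fin M, (if (∀ k, cdist (y k) (x k) < n) then (1 : ℝ) else 0)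
      * (if (∀ k, cdist (z k) (x k) < n) then (1 : ℝ) else 0) := by
  have h1 : ((2 * (n - 2) - 1 : ℕ) : ℝ) ^ 4
      = ∑ x : Fin 4 → Fin M, (if (∀ k, cdist (y k) (x k) < n - 2) then (1 : ℝ) else 0) := by
    rw [Finset.sum_boole, knabe_box_card (n - 2) (by omega) y, Nat.cast_pow]
  rw [h1]
  refine Finset.sum_le_sum fun x _ => ?_
  by_cases hx : ∀ k, cdist (y k) (x k) < n - 2
  · have hy : ∀ k, cdist (y k) (x k) < n := fun k => by have := hx k; omega
    have hz : ∀ k, cdist (z k) (x k) < n := fun k => by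
      have h1 := hx k
      have h2 := hyz k
      have h3 := knabe_cdist_triangle (z k) (y k) (x k)
      have h4 := knabe_cdist_comm (y k) (z k)
      omega
    rw [if_pos hx, if_pos hy, if_pos hz]
    norm_num
  · rw [if_neg hx]
    exact mul_nonneg (by split_ifs <;> norm_num) (by split_ifs <;> norm_num)

/-- The polynomial estimate `(2n-1)⁴ - (2(n-2)-1)₊⁴ ≤ 16 (2n-1)³` for `n ≥ 1`. -/
private theorem knabe_poly (n : ℕ) (hn : 1 ≤ n) :
    ((2 * n - 1 : ℕ) : ℝ) ^ 4 - ((2 * (n - 2) - 1 : ℕ) : ℝ) ^ 4 ≤ 16 * ((2 * n - 1 : ℕ) : ℝ) ^ 3 := by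
  rcases (show n = 1 ∨ n = 2 ∨ 3 ≤ n by omega) with rfl | rfl | h3
  · norm_num
  · norm_num
  · obtain ⟨m, rfl⟩ : ∃ m, n = m + 3 := ⟨n - 3, by omega⟩
    rw [(by omega : (2 * (m + 3) - 1 : ℕ) = 2 * m + 5), (by omega : (2 * (m + 3 - 2) - 1 : ℕ) = 2 * m + 1)]
    push_cast
    nlinarith [sq_nonneg (m : ℝ), (m.cast_nonneg : (0 : ℝ) ≤ m)]

/-- Near-pair defect sum: `∑_{z near y} (N_p - N(y,z)) ≤ 625 · 16 (2n-1)³ ≤ N_p · (10000 / n)`. -/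
private theorem knabe_near_sum {M : ℕ} [NeZero M] (n : ℕ) (hn : 1 ≤ n) (hM : 4 * (n + 2) ≤ M)
    (y : Fin 4 → Fin M) :
    ∑ z ∈ Finset.univ.filter (fun z : Fin 4 → Fin M => ∀ k, cdist (y k) (z k) ≤ 2),
      (((2 * n - 1 : ℕ) : ℝ) ^ 4 - ∑ x : Fin 4 → Fin M, (if (∀ k, cdist (y k) (x k) < n) then (1 : ℝ) else 0)
          * (if (∀ k, cdist (z k) (x k) < n) then (1 : ℝ) else 0)) ≤ ((2 * n - 1 : ℕ) : ℝ) ^ 4 * (10000 / n) := by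
  have hstep : ∀ z ∈ Finset.univ.filter (fun z : Fin 4 → Fin M => ∀ k, cdist (y k) (z k) ≤ 2),
      (((2 * n - 1 : ℕ) : ℝ) ^ 4 - ∑ x : Fin 4 → Fin M, (if (∀ k, cdist (y k) (x k) < n) then (1 : ℝ) else 0)
          * (if (∀ k, cdist (z k) (x k) < n) then (1 : ℝ) else 0)) ≤ 16 * ((2 * n - 1 : ℕ) : ℝ) ^ 3 := by
    intro z hz
    simp only [Finset.mem_filter, Finset.mem_univ, true_and] at hz
    linarith [knabe_count_near_lower n (by omega) y z hz, knabe_poly n hn]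
  refine (Finset.sum_le_card_nsmul _ _ _ hstep).trans ?_
  rw [knabe_count_near (by omega) y, nsmul_eq_mul]
  have hL0 : (0 : ℝ) < ((2 * n - 1 : ℕ) : ℝ) := by exact_mod_cast (by omega : 0 < 2 * n - 1)
  have hnL : (n : ℝ) ≤ ((2 * n - 1 : ℕ) : ℝ) := by exact_mod_cast (by omega : n ≤ 2 * n - 1)
  rw [mul_div_assoc', le_div_iff₀ (by exact_mod_cast (by omega : 0 < n) : (0 : ℝ) < n)]
  push_cast
  nlinarith [pow_pos hL0 3, mul_le_mul_of_nonneg_left hnL (pow_pos hL0 3).le]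

/-- The scalar core of Knabe's squaring argument: from the summed local inequality
`γ N_p S ≤ ∑ N(y,z) q(y,z)` to `(γ - τ) S ≤ ∑ q(y,z)`, splitting pairs into far ones (`q ≥ 0`, `N ≤ N_p`) and
near ones (`-2q(y,z) ≤ q(y,y) + q(z,z)` and the defect bound `∑_{z near y} (N_p - N(y,z)) ≤ N_p τ`). -/
private theorem knabe_abstract {ι : Type*} [Fintype ι] (near : ι → ι → Prop) [DecidableRel near]
    (q N : ι → ι → ℝ) (Np τ γ : ℝ) (hNp : 0 < Np) (near_symm : ∀ y z, near y z → near z y)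
    (q_diag : ∀ y, 0 ≤ q y y) (q_bound : ∀ y z, -(2 * q y z) ≤ q y y + q z z)
    (q_far : ∀ y z, ¬ near y z → 0 ≤ q y z) (N_symm : ∀ y z, N y z = N z y) (N_le : ∀ y z, N y z ≤ Np)
    (N_near : ∀ y, ∑ z ∈ Finset.univ.filter (near y), (Np - N y z) ≤ Np * τ)
    (hyp : γ * (Np * ∑ y, q y y) ≤ ∑ y, ∑ z, N y z * q y z) :
    (γ - τ) * ∑ y, q y y ≤ ∑ y, ∑ z, q y z := by
  have hDs : ∀ y z, (if near y z then Np - N y z else 0) = if near z y then Np - N z y else 0 := fun y z => by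
    rw [N_symm y z]
    by_cases h : near y z
    · rw [if_pos h, if_pos (near_symm _ _ h)]
    · rw [if_neg h, if_neg fun h' => h (near_symm _ _ h')]
  have hD : ∀ y z, N y z * q y z ≤ Np * q y z + ((if near y z then Np - N y z else 0) * q y y / 2
      + (if near z y then Np - N z y else 0) * q z z / 2) := fun y z => by
    rw [← hDs y z]
    have h1 : 0 ≤ Np - N y z := sub_nonneg.mpr (N_le y z)
    split_ifs with h
    · nlinarith [q_bound y z]
    · nlinarith [q_far y z h]
  have hrow : ∀ y, ∑ z, (if near y z then Np - N y z else 0) * q y y / 2 ≤ Np * τ * q y y / 2 := fun y => by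
    rw [← Finset.sum_div, ← Finset.sum_mul]
    refine div_le_div_of_nonneg_right (mul_le_mul_of_nonneg_right ?_ (q_diag y)) two_pos.le
    rw [← Finset.sum_filter]
    exact N_near y
  have hmain : ∑ y, ∑ z, N y z * q y z ≤ Np * ∑ y, ∑ z, q y z + Np * τ * ∑ y, q y y :=
    calc ∑ y, ∑ z, N y z * q y z
        ≤ ∑ y, ∑ z, (Np * q y z + ((if near y z then Np - N y z else 0) * q y y / 2
            + (if near z y then Np - N z y else 0) * q z z / 2)) :=
          Finset.sum_le_sum fun y _ => Finset.sum_le_sum fun z _ => hD y z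
      _ = Np * ∑ y, ∑ z, q y z + ((∑ y, ∑ z, (if near y z then Np - N y z else 0) * q y y / 2)
            + ∑ y, ∑ z, (if near z y then Np - N z y else 0) * q z z / 2) := by
          simp only [Finset.sum_add_distrib, Finset.mul_sum]
      _ = Np * ∑ y, ∑ z, q y z + 2 * ∑ y, ∑ z, (if near y z then Np - N y z else 0) * q y y / 2 := by
          rw [two_mul]
          congr 2
          exact Finset.sum_comm
      _ ≤ Np * ∑ y, ∑ z, q y z + 2 * ∑ y, Np * τ * q y y / 2 :=
          add_le_add (le_refl _) (mul_le_mul_of_nonneg_left (Finset.sum_le_sum fun y _ => hrow y) two_pos.le)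
      _ = Np * ∑ y, ∑ z, q y z + Np * τ * ∑ y, q y y := by
          congr 1
          rw [Finset.mul_sum, Finset.mul_sum]
          exact Finset.sum_congr rfl fun y _ => by ring
  have h2 : Np * ((γ - τ) * ∑ y, q y y) ≤ Np * ∑ y, ∑ z, q y z := by nlinarith [hmain, hyp]
  exact le_of_mul_le_mul_left h2 hNp

/-- For an orthogonal projection, `⟪P v, v⟫ = ⟪P v, P v⟫`. -/
private theorem knabe_proj_inner {E : Type} [NormedAddCommGroup E] [InnerProductSpace ℝ E]
    [CompleteSpace E] {P : E →L[ℝ] E} (hP : IsSelfAdjoint P ∧ P * P = P) (v : E) :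
    ⟪P v, v⟫_ℝ = ⟪P v, P v⟫_ℝ := by
  have hs : ∀ a b, ⟪P a, b⟫_ℝ = ⟪a, P b⟫_ℝ := fun a b => hP.1.isSymmetric a b
  conv_lhs => rw [← hP.2, mul_apply_eq_comp]
  exact hs _ _

/-- Commuting orthogonal projections have a nonnegative mixed form: `⟪P v, R v⟫ = ‖P R v‖² ≥ 0`. -/
private theorem knabe_comm_proj_nonneg {E : Type} [NormedAddCommGroup E] [InnerProductSpace ℝ E]
    [CompleteSpace E] {P R : E →L[ℝ] E} (hP : IsSelfAdjoint P ∧ P * P = P)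
    (hR : IsSelfAdjoint R ∧ R * R = R) (h : P * R = R * P) (v : E) : 0 ≤ ⟪P v, R v⟫_ℝ := by
  have hPs : ∀ a b, ⟪P a, b⟫_ℝ = ⟪a, P b⟫_ℝ := fun a b => hP.1.isSymmetric a b
  have hRs : ∀ a b, ⟪R a, b⟫_ℝ = ⟪a, R b⟫_ℝ := fun a b => hR.1.isSymmetric a b
  have hu : R (R v) = R v := by rw [← mul_apply_eq_comp, hR.2]
  have key : ⟪P v, R v⟫_ℝ = ⟪P (R v), P (R v)⟫_ℝ :=
    calc ⟪P v, R v⟫_ℝ = ⟪v, P (R (R v))⟫_ℝ := by rw [hu]; exact hPs v (R v)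
      _ = ⟪v, R (P (R v))⟫_ℝ := by rw [← mul_apply_eq_comp P R, h, mul_apply_eq_comp]
      _ = ⟪R v, P (P (R v))⟫_ℝ := by rw [← mul_apply_eq_comp P P, hP.2]; exact (hRs v (P (R v))).symm
      _ = ⟪P (R v), P (R v)⟫_ℝ := (hPs (R v) (P (R v))).symm
  rw [key]
  exact real_inner_self_nonneg

/-- The Loewner order evaluated on the diagonal: `A ≤ B → ⟪A v, v⟫ ≤ ⟪B v, v⟫`. -/
private theorem knabe_inner_le_of_le {E : Type} [NormedAddCommGroup E] [InnerProductSpace ℝ E]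
    {A B : E →L[ℝ] E} (h : A ≤ B) (v : E) : ⟪A v, v⟫_ℝ ≤ ⟪B v, v⟫_ℝ := by
  rw [ContinuousLinearMap.le_def] at h
  have h2 := h.inner_nonneg_left v
  rw [sub_apply, inner_sub_left] at h2
  linarith

/-- The Loewner order from the diagonal, for symmetric operators on a real space. -/
private theorem knabe_le_of_inner {E : Type} [NormedAddCommGroup E] [InnerProductSpace ℝ E]
    {A B : E →L[ℝ] E} (hA : ∀ a b, ⟪A a, b⟫_ℝ = ⟪a, A b⟫_ℝ) (hB : ∀ a b, ⟪B a, b⟫_ℝ = ⟪a, B b⟫_ℝ)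
    (h : ∀ v, ⟪A v, v⟫_ℝ ≤ ⟪B v, v⟫_ℝ) : A ≤ B := by
  rw [ContinuousLinearMap.le_def, ContinuousLinearMap.isPositive_iff]
  refine ⟨fun a b => ?_, fun v => ?_⟩
  · show ⟪(B - A) a, b⟫_ℝ = ⟪a, (B - A) b⟫_ℝ
    simp only [sub_apply, inner_sub_left, inner_sub_right, hA a b, hB a b]
  · show 0 ≤ ⟪(B - A) v, v⟫_ℝ
    rw [sub_apply, inner_sub_left]
    exact sub_nonneg.mpr (h v)

/-- **Knabe's squaring argument** with non-commuting radius `2`, threshold `10000 / n` and constant `1`: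
for orthogonal projections `Q x` on a real Hilbert space indexed by `(ℤ/M)⁴`, commuting unless all four index
distances are `≤ 2`, the local inequalities `γ A_x ≤ A_x²` for the `n`-patch operators imply
`(γ - 10000/n) H ≤ H²` for the total operator (Knabe 1988 §2; Gosset–Mozgunov 2016 Thm. 1). -/
private theorem knabe_main {M : ℕ} {E : Type} [NormedAddCommGroup E] [InnerProductSpace ℝ E]
    [CompleteSpace E] (Q : (Fin 4 → Fin M) → (E →L[ℝ] E)) (hQ : ∀ x, IsSelfAdjoint (Q x) ∧ Q x * Q x = Q x)
    (hcomm : ∀ x y, (∃ k, 2 < cdist (x k) (y k)) → Q x * Q y = Q y * Q x) (n : ℕ) (γ : ℝ) (hn : 1 ≤ n)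
    (hM : 4 * (n + 2) ≤ M) (hloc : ∀ x : Fin 4 → Fin M, γ • patchOp Q n x ≤ patchOp Q n x * patchOp Q n x) :
    (1 * (γ - 10000 / (n : ℝ))) • totalOp Q ≤ totalOp Q * totalOp Q := by
  haveI : NeZero M := ⟨by omega⟩
  -- symmetry of the `Q x`, of `H = totalOp Q` and of the `A_x = patchOp Q n x`; the patch indicator `ind`
  have hQs : ∀ x a b, ⟪Q x a, b⟫_ℝ = ⟪a, Q x b⟫_ℝ := fun x a b => (hQ x).1.isSymmetric a b
  have hH_apply : ∀ v, totalOp Q v = ∑ x, Q x v := fun v => by simp only [totalOp, sum_apply]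
  have hHs : ∀ a b, ⟪totalOp Q a, b⟫_ℝ = ⟪a, totalOp Q b⟫_ℝ := fun a b => by
    simp only [hH_apply, sum_inner, inner_sum]
    exact Finset.sum_congr rfl fun x _ => hQs x a b
  obtain ⟨ind, hind⟩ : ∃ ind : (Fin 4 → Fin M) → (Fin 4 → Fin M) → ℝ,
      ∀ x y, ind x y = if (∀ k, cdist (y k) (x k) < n) then 1 else 0 := ⟨_, fun _ _ => rfl⟩
  have hind01 : ∀ x y, 0 ≤ ind x y ∧ ind x y ≤ 1 := fun x y => by rw [hind]; split_ifs <;> norm_num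
  have hA_apply : ∀ x v, patchOp Q n x v = ∑ y, ind x y • Q y v := fun x v => by
    simp only [patchOp, sum_apply]
    refine Finset.sum_congr rfl fun y _ => ?_
    rw [hind]
    split_ifs <;> simp
  have hAs : ∀ x a b, ⟪patchOp Q n x a, b⟫_ℝ = ⟪a, patchOp Q n x b⟫_ℝ := fun x a b => by
    simp only [hA_apply, sum_inner, inner_sum, real_inner_smul_left, real_inner_smul_right]
    exact Finset.sum_congr rfl fun y _ => by rw [hQs y a b]
  have hL0 : (0 : ℝ) < ((2 * n - 1 : ℕ) : ℝ) := by exact_mod_cast (by omega : 0 < 2 * n - 1)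
  have hdiag : ∀ y, ∑ x, ind x y = ((2 * n - 1 : ℕ) : ℝ) ^ 4 := fun y => by
    simp only [hind]
    exact knabe_count_diag n (by omega) y
  -- reduce to the diagonal of the quadratic forms at a vector `v`; `q y z = ⟪Q y v, Q z v⟫`
  refine knabe_le_of_inner (fun a b => ?_) (fun a b => ?_) (fun v => ?_)
  · simp only [smul_apply, real_inner_smul_left, real_inner_smul_right, hHs a b]
  · simp only [mul_apply_eq_comp]
    rw [hHs (totalOp Q a) b, hHs a (totalOp Q b)]
  obtain ⟨q, hq⟩ : ∃ q : (Fin 4 → Fin M) → (Fin 4 → Fin M) → ℝ, ∀ y z, q y z = ⟪Q y v, Q z v⟫_ℝ :=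
    ⟨_, fun _ _ => rfl⟩
  have hS : ⟪totalOp Q v, v⟫_ℝ = ∑ y, q y y := by
    rw [hH_apply, sum_inner]
    exact Finset.sum_congr rfl fun y _ => by rw [hq, knabe_proj_inner (hQ y)]
  have hT : ⟪totalOp Q v, totalOp Q v⟫_ℝ = ∑ y, ∑ z, q y z := by
    rw [hH_apply, sum_inner]
    refine Finset.sum_congr rfl fun y _ => ?_
    rw [inner_sum]
    exact Finset.sum_congr rfl fun z _ => (hq y z).symm
  -- the local hypothesis on the diagonal, summed over `x`
  have hlocv : ∀ x, γ * ∑ y, ind x y * q y y ≤ ∑ y, ∑ z, ind x y * ind x z * q y z := fun x => by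
    have h1 := knabe_inner_le_of_le (hloc x) v
    rw [smul_apply, real_inner_smul_left, mul_apply_eq_comp, hAs x (patchOp Q n x v) v] at h1
    have e1 : ⟪patchOp Q n x v, v⟫_ℝ = ∑ y, ind x y * q y y := by
      rw [hA_apply, sum_inner]
      exact Finset.sum_congr rfl fun y _ => by rw [real_inner_smul_left, hq, knabe_proj_inner (hQ y)]
    have e2 : ⟪patchOp Q n x v, patchOp Q n x v⟫_ℝ = ∑ y, ∑ z, ind x y * ind x z * q y z := by
      rw [hA_apply, sum_inner]
      refine Finset.sum_congr rfl fun y _ => ?_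
      rw [inner_sum]
      exact Finset.sum_congr rfl fun z _ => by rw [real_inner_smul_left, real_inner_smul_right, hq]; ring
    rwa [e1, e2] at h1
  have hyp : γ * (((2 * n - 1 : ℕ) : ℝ) ^ 4 * ∑ y, q y y) ≤ ∑ y, ∑ z, (∑ x, ind x y * ind x z) * q y z := by
    have h1 : ∑ x, γ * ∑ y, ind x y * q y y ≤ ∑ x, ∑ y, ∑ z, ind x y * ind x z * q y z :=
      Finset.sum_le_sum fun x _ => hlocv x
    have e1 : ∑ x, γ * ∑ y, ind x y * q y y = γ * (((2 * n - 1 : ℕ) : ℝ) ^ 4 * ∑ y, q y y) := by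
      rw [← Finset.mul_sum, Finset.sum_comm]
      congr 1
      rw [Finset.mul_sum]
      exact Finset.sum_congr rfl fun y _ => by rw [← Finset.sum_mul, hdiag y]
    have e2 : ∑ x, ∑ y, ∑ z, ind x y * ind x z * q y z = ∑ y, ∑ z, (∑ x, ind x y * ind x z) * q y z := by
      rw [Finset.sum_comm]
      refine Finset.sum_congr rfl fun y _ => ?_
      rw [Finset.sum_comm]
      exact Finset.sum_congr rfl fun z _ => by rw [Finset.sum_mul]
    rwa [e1, e2] at h1
  -- hypotheses of the scalar core
  have near_symm : ∀ y z : Fin 4 → Fin M, (∀ k, cdist (y k) (z k) ≤ 2) → ∀ k, cdist (z k) (y k) ≤ 2 :=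
    fun y z h k => by rw [knabe_cdist_comm]; exact h k
  have q_diag : ∀ y, 0 ≤ q y y := fun y => by rw [hq]; exact real_inner_self_nonneg
  have q_bound : ∀ y z, -(2 * q y z) ≤ q y y + q z z := fun y z => by
    have h0 := real_inner_self_nonneg (x := Q y v + Q z v)
    rw [real_inner_add_add_self] at h0
    rw [hq, hq, hq]
    linarith
  have q_far : ∀ y z : Fin 4 → Fin M, ¬ (∀ k, cdist (y k) (z k) ≤ 2) → 0 ≤ q y z := fun y z h => by
    push Not at h
    rw [hq]
    exact knabe_comm_proj_nonneg (hQ y) (hQ z) (hcomm y z (h.imp fun k hk => hk)) v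
  have N_symm : ∀ y z, ∑ x, ind x y * ind x z = ∑ x, ind x z * ind x y :=
    fun y z => Finset.sum_congr rfl fun x _ => mul_comm _ _
  have N_le : ∀ y z, ∑ x, ind x y * ind x z ≤ ((2 * n - 1 : ℕ) : ℝ) ^ 4 := fun y z => by
    rw [← hdiag y]
    exact Finset.sum_le_sum fun x _ => mul_le_of_le_one_right (hind01 x y).1 (hind01 x z).2
  have N_near : ∀ y, ∑ z ∈ Finset.univ.filter (fun z : Fin 4 → Fin M => ∀ k, cdist (y k) (z k) ≤ 2),
      (((2 * n - 1 : ℕ) : ℝ) ^ 4 - ∑ x, ind x y * ind x z) ≤ ((2 * n - 1 : ℕ) : ℝ) ^ 4 * (10000 / n) := by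
    intro y
    simp only [hind]
    exact knabe_near_sum n hn hM y
  have key : (γ - 10000 / n) * ∑ y, q y y ≤ ∑ y, ∑ z, q y z :=
    knabe_abstract (fun y z : Fin 4 → Fin M => ∀ k, cdist (y k) (z k) ≤ 2) q (fun y z => ∑ x, ind x y * ind x z)
      _ _ γ (pow_pos hL0 4) near_symm q_diag q_bound q_far N_symm N_le N_near hyp
  rw [smul_apply, real_inner_smul_left, mul_apply_eq_comp, hHs (totalOp Q v) v, hS, hT, one_mul]
  exact key

/-- **Stub S1 of line `knabe-block-sampler`** (Knabe amplification, radius 2): there are a threshold `t n → 0` and a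
constant `c > 0` with `KnabeWith 2 t c`. -/
theorem stub_knabeAmplification : ∃ (t : ℕ → ℝ) (c : ℝ), 0 < c ∧ Tendsto t atTop (𝓝 0) ∧ KnabeWith 2 t c := by
  refine ⟨fun n => 10000 / (n : ℝ), 1, one_pos, tendsto_const_div_atTop_nhds_zero_nat 10000, ?_⟩
  intro M E _ _ _ Q hQ hcomm n γ hn hM _ hloc
  exact knabe_main Q hQ hcomm n γ hn hM hloc

end Summit.QuantumFields.YangMills.Theorems.LatticeGapInUVUnits.KnabeBlockSampler

end
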